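import Summits.CriticalPhenomena.PercolationContinuityZ3.Theorems.Transplant.SkelFrmBChoiceRootReadRows
import Summits.CriticalPhenomena.PercolationContinuityZ3.Theorems.Transplant.SkelFrmBChoiceRootReadRowsP
import Summits.CriticalPhenomena.PercolationContinuityZ3.Theorems.Transplant.SkelFrmBChoiceRootReadDefs
import HarnessLib

/-!
# N2 (frames-only node `SamePDropOfSkeletonFrm₁`, OPEN) — THE FOUR ROOT READING ROWS BY NAME: `KS.RowX1 / RowXA / RowX2 / RowYA`
# (p3-g18's SkelFrmBChoiceRootReadDefs, p369201) HOLD at the (C)/(R) tuple of record `(qx, Wx | qxY, WxY | c, b) := (qxQ4, WxQ4 | qxYQ4, WxYQ4 |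
# cR2vW mk, BSlot.small3)` under the slot floors `gFloorKG ≤ g`, `40·K·R'0 ≤ g` and `5 ≤ Kq` — each by `unfold KS.Row… KS.ReadRow; exact` the value
# row of SkelFrmBChoiceRootReadRows (`rootReadX1_Q`, `rootReadXA_Q`, `rootReadYA_QT`) / SkelFrmBChoiceRootReadRowsP (`rootReadX2_Q`).

* `rowX1_Q`, `rowXA_Q`, `rowX2_Q`, `rowYA_Q` — the `HX1/HXA/HX2/HYA` inputs of p3-g18's `rootHoldsNQWFnLK_frmChoiceAllQ3V_R` at any box slot `gv`
  dominating the two floors (with `g := gOf O gv`, `hN := eqNumL_of_atQ (atQ3_of_atQ3V hAt)`, `hKq` from `200 ≤ κ.K₀` by `Neg.kq_ge_of_le`).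
NON-VACUITY: value rows at the closed tuple (era-3 windows `q = 98·n_L`, `W = 20·sL + 42`, `b = (76·s₀, 19·s₁)`).
builds on p205010 (kernel theorem, internal audit signed; external expert review pending) — nothing in this file uses p205010; NOTHING is claimed about the open
node `SamePDropOfSkeletonFrm₁`.
Lane `prim-bschramm`, seat `prim-bschramm-stmt` (gen 22); helper file (`--supports stmt-CriticalPhenomena-4575 --as helper`).
[cite: KozmaNitzan2024, §4 p. 28 ((32) at the root); Lemma 12 pp. 23–25] [cite: MartineauTassion2017, §4.3 Lemma 4.2]
-/

noncomputable section

namespace Summit.CriticalPhenomena.PercolationContinuityZ3.Theorems.Transplant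

namespace PlanarSkeletonFrm

namespace NegB

open Neg

variable (κ : SkelConc.Consts) {V : Type} [DecidableEq V] [Countable V] {G : SimpleGraph V} [G.LocallyFinite] (Φ : PlanarSkeletonFrm G) (t : V) (p : unitInterval)
  (D : Skelφ.StepI.DataNS V) (g f mk : ℕ)

/-- (R-X1) discharges `KS.RowX1` at `(qxQ4, WxQ4)`. [this work] -/
theorem rowX1_Q (hKq : 5 ≤ Neg.Kq κ) (hN : EqNumL κ Φ t p D g f) (hg : gFloorKG κ Φ t p D mk ≤ g) (hg2 : 40 * Neg.K κ * KS0.R'0 κ Φ t p D mk ≤ g) :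
    KS.RowX1 κ Φ t p D mk g f (qxQ4 κ Φ t p D g f) (WxQ4 κ Φ t p D g f) := by
  unfold KS.RowX1 KS.ReadRow; exact rootReadX1_Q κ Φ t p D g f mk hKq hN hg hg2

/-- (R-XA) discharges `KS.RowXA` at `(qxQ4, WxQ4 | cR2vW mk, small3)`. [this work] -/
theorem rowXA_Q (hKq : 5 ≤ Neg.Kq κ) (hN : EqNumL κ Φ t p D g f) (hg : gFloorKG κ Φ t p D mk ≤ g) (hg2 : 40 * Neg.K κ * KS0.R'0 κ Φ t p D mk ≤ g) :
    KS.RowXA κ Φ t p D mk g f (qxQ4 κ Φ t p D g f) (WxQ4 κ Φ t p D g f) (cR2vW κ Φ t p D g f mk) (BSlot.small3 κ Φ t p D g f) hN hg := by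
  unfold KS.RowXA KS.ReadRow; exact rootReadXA_Q κ Φ t p D g f mk hKq hN hg hg2

/-- (R-X2) discharges `KS.RowX2`. [this work] -/
theorem rowX2_Q (hN : EqNumL κ Φ t p D g f) (hg : gFloorKG κ Φ t p D mk ≤ g) (hg2 : 40 * Neg.K κ * KS0.R'0 κ Φ t p D mk ≤ g) :
    KS.RowX2 κ Φ t p D mk g f := by
  unfold KS.RowX2 KS.ReadRow; exact rootReadX2_Q κ Φ t p D mk g f hN hg hg2

/-- (R-YA) discharges `KS.RowYA` at `(qxYQ4, WxYQ4 | cR2vW mk, small3)`. [this work] -/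
theorem rowYA_Q (hKq : 5 ≤ Neg.Kq κ) (hN : EqNumL κ Φ t p D g f) (hg : gFloorKG κ Φ t p D mk ≤ g) (hg2 : 40 * Neg.K κ * KS0.R'0 κ Φ t p D mk ≤ g) :
    KS.RowYA κ Φ t p D mk g f (qxYQ4 κ Φ t p D g f) (WxYQ4 κ Φ t p D g f) (cR2vW κ Φ t p D g f mk) (BSlot.small3 κ Φ t p D g f) hN hg := by
  unfold KS.RowYA KS.ReadRow; exact rootReadYA_QT κ Φ t p D g f mk hKq hN hg hg2

end NegB

end PlanarSkeletonFrm

end Summit.CriticalPhenomena.PercolationContinuityZ3.Theorems.Transplant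

end
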